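import Mathlib
import HarnessLib
import Literature.Analysis.FluidPDE.SelfSimilar
import Literature.Analysis.FluidPDE.ClassicalSolution
import Literature.Analysis.FluidPDE.VectorCalculus
import Literature.Analysis.FluidPDE.VectorCalculusProofs
import Literature.Analysis.FluidPDE.VorticityCalculus
import Literature.Analysis.FluidPDE.CurlFreeLiouville
import Literature.Analysis.FluidPDE.CurlIsometryCovariance
import Literature.Analysis.FluidPDE.IsometryInvariance
import Literature.Analysis.FluidPDE.KatoSymmetryCovariance
import Literature.Analysis.FluidPDE.NSVelocityUniqueness
import Literature.Analysis.FluidPDE.NSBoundedMildOseenClassical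
import Literature.Analysis.FluidPDE.AxisymmetricEuler
import Literature.Analysis.FluidPDE.SwirlTransportProofs
import Literature.Analysis.FluidPDE.AxisymmetricVorticityTransport
import Literature.Analysis.FluidPDE.PineauVicolEnstrophyTime
import Literature.Analysis.FluidPDE.TaoEnstrophyLocalisation
import Summits.NavierStokesRegularity.NavierStokesRegularity.Theorems.UnthreadedDoorNetFluxDefs
import Summits.NavierStokesRegularity.NavierStokesRegularity.Theorems.UnthreadedDoorCellFluxZDefs
import Summits.NavierStokesRegularity.NavierStokesRegularity.Theorems.DssFarFieldSlavingBlowupTypeIDssProfileTiltedIsotropyCalculus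
import Summits.NavierStokesRegularity.NavierStokesRegularity.Theorems.PoloidalWindowDoorPoloidalWindowRigidityAxisymmetric

/-!
# Route `UnthreadedDoor`, crux `PoloidalLiouville` (stmt-NavierStokesRegularity-1222), WALL W1 — cell-flux Z skeleton, stub Z-1a
# `ZonalKinematic` PROVED (`Cruxes/PoloidalLiouville/CellFluxZSkeleton.lean` v1.1 c6ae0be7f8d8, custodian ns-idea-14 g6; critic ns-wall-crit-1 V22)

`zonalKinematic : CellFlux.ZonalKinematic` (Theorems-side twin of the skeleton's `ZSkeleton.ZonalKinematic`, body VERBATIM): at every time `t < 0`,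
a bounded ancient mild solution `v` (`ν = 1`), jointly smooth on the slab, whose vorticity is UNTHREADED about `x₀` (`ω = ∇T × (x − x₀)`, so
`ω ⊥ x − x₀`) and ZONAL (`ω(t,·) ⊥ e` for a fixed `e ≠ 0`) is, after subtracting the constant `c = v t x₀`, EXACTLY axisymmetric WITHOUT swirl about
the axis `x₀ + ℝe`, in a frame `R` (a linear isometry with `R (e/‖e‖) = e_z`; we take the reflection exchanging the two unit vectors).

PROOF (kinematic, one slice; the skeleton's «cocycle averaging» is replaced by an explicit coboundary).
* KEY LEMMA `fderiv_rotGen_eq_rotGen` (pointwise linear algebra): a `C¹` field `ω` on `ℝ³` which is horizontal (`ω₂ ≡ 0`), unthreaded about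
  the axis through `0` (`⟪y, ω(y)⟫ ≡ 0`) and divergence free satisfies the infinitesimal axisymmetry `Dω(z)[Jz] = J ω(z)` at EVERY point
  (differentiate the two identities, use `tr Dω = 0`; no division by the cylindrical radius), hence is axisymmetric
  (`TiltedIsotropy.isAxisymmetric_of_fderiv_rotGen`).
* COBOUNDARY `isAxisymmetric_sub_apply_zero`: if `W` is `C²`, bounded, divergence free with axisymmetric `curl W`, then for every angle `θ` the field
  `R_θ W R_{−θ} − W` is bounded, divergence free and CURL FREE (`curl (R_θ W R_{−θ}) = R_θ (curl W) R_{−θ} = curl W`), hence constant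
  (KNSS 2009 Lemma 3.1, tree `eq_of_curl_eq_zero_of_isDivFree_of_bounded`); evaluating the constant at the axis point `0` shows that
  `W − W(0)` is axisymmetric (the cocycle `θ ↦ R_θ W R_{−θ} − W` is the coboundary of `−W(0)`).
* NO SWIRL: an axisymmetric differentiable field with `(curl)_z ≡ 0` has no swirl (tree
  `PoloidalWindowDoorPoloidalWindowRigidityAxisymmetric.hasNoSwirl_of_isAxisymmetric_of_curl_two_eq_zero`).
* FRAME: `W := conjAxis R x₀ (v t) = R ∘ v t ∘ (R⁻¹ · + x₀)`; the pseudovector law `⟪curl (R u R⁻¹)(y), e'⟫ = 0 ↔ ⟪curl u (R⁻¹y), R⁻¹e'⟫ = 0`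
  (`inner_curl_conj_linearIsometryEquiv_eq_zero_iff`) transports `ω ⊥ e`, `ω ⊥ x − x₀` to `(curl W)_z = 0`, `curl W ⊥ y`; the slice is smooth,
  bounded and (weakly, hence classically) divergence free; `conjAxis R x₀ (v t − v t x₀) = W − W 0`.

WHAT THIS IS NOT: one of four stubs of Z (`ZonalUnthreadedVorticityVanishes`), itself information-grade for W1 (critic V22-P6 (a)); `PoloidalLiouville`
(1222), Z, W1 and NS regularity stay OPEN.  `--supports stmt-NavierStokesRegularity-1222 --as helper`.  [folklore]
-/

noncomputable section

-- the summit and its single sub-problem share the name (CONVENTIONS §1)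
set_option linter.dupNamespace false

open Set Function Filter Topology MeasureTheory Metric
open scoped RealInnerProductSpace

namespace Summit.NavierStokesRegularity.NavierStokesRegularity.Theorems.PoloidalLiouville.CellFlux

open Summit.NavierStokesRegularity.NavierStokesRegularity.Theorems.PoloidalLiouville.NetFlux (E3)
open Literature.Analysis Literature.Analysis.FluidPDE
open Summit.NavierStokesRegularity.NavierStokesRegularity.Theorems.TiltedIsotropy (isAxisymmetric_of_fderiv_rotGen)
open Summit.NavierStokesRegularity.NavierStokesRegularity.Theorems.PoloidalWindowDoorPoloidalWindowRigidityAxisymmetric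
  (hasNoSwirl_of_isAxisymmetric_of_curl_two_eq_zero)

/-! ### Pointwise linear algebra: the key lemma -/

/-- `a × b ⟂ b` (coordinates). -/
private theorem inner_cross_self_right (a b : E3) : ⟪cross a b, b⟫ = 0 := by
  simp only [cross, PiLp.inner_apply, cross_apply, RCLike.inner_apply, conj_trivial,
    Fin.sum_univ_three, Matrix.cons_val_zero, Matrix.cons_val_one, Matrix.cons_val_two,
    Matrix.head_cons, Matrix.tail_cons]
  ring

/-- **KEY LEMMA (infinitesimal axisymmetry of a horizontal, unthreaded, solenoidal field).**  If `ω : ℝ³ → ℝ³` is differentiable, horizontal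
(`ω(y)₂ = 0`), orthogonal to the position vector (`⟪y, ω(y)⟫ = 0`) and divergence free, then `Dω(z)[J z] = J ω(z)` at every point `z`,
`J = rotGen` the generator of the rotations about the `x₂`-axis.  Differentiating `ω₂ ≡ 0` and `⟪y, ω⟫ ≡ 0` gives `(Dω h)₂ = 0` and
`⟪h, ω(z)⟫ + ⟪z, Dω(z) h⟫ = 0`; with `tr Dω(z) = 0` the two horizontal components of both sides agree (pure algebra, valid on the axis too). [folklore] -/
theorem fderiv_rotGen_eq_rotGen {ω : E3 → E3} (hd : Differentiable ℝ ω) (hz : ∀ y, ω y 2 = 0)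
    (hperp : ∀ y, ⟪y, ω y⟫ = 0) (hdiv : VectorCalculus.IsDivFree ω) (z : E3) :
    fderiv ℝ ω z (rotGen z) = rotGen (ω z) := by
  set A : E3 →L[ℝ] E3 := fderiv ℝ ω z with hA
  -- (2) the third component of `A h` vanishes
  have h2 : ∀ h, A h 2 = 0 := by
    intro h
    have hD : HasFDerivAt ((EuclideanSpace.proj (2 : Fin 3) : E3 →L[ℝ] ℝ) ∘ ω)
        ((EuclideanSpace.proj (2 : Fin 3) : E3 →L[ℝ] ℝ).comp A) z :=
      (EuclideanSpace.proj (2 : Fin 3) : E3 →L[ℝ] ℝ).hasFDerivAt.comp z (hd z).hasFDerivAt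
    have hzero : ((EuclideanSpace.proj (2 : Fin 3) : E3 →L[ℝ] ℝ) ∘ ω) = fun _ => (0 : ℝ) :=
      funext fun y => hz y
    have hD0 : HasFDerivAt ((EuclideanSpace.proj (2 : Fin 3) : E3 →L[ℝ] ℝ) ∘ ω) (0 : E3 →L[ℝ] ℝ) z := by
      rw [hzero]
      exact hasFDerivAt_const (0 : ℝ) z
    have := congrArg (fun L : E3 →L[ℝ] ℝ => L h) (hD.unique hD0)
    simpa using this
  -- (1) `⟪h, ω z⟫ + ⟪z, A h⟫ = 0`
  have h1 : ∀ h, ⟪h, ω z⟫ + ⟪z, A h⟫ = 0 := by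
    intro h
    have hzero : (fun y : E3 => ⟪y, ω y⟫) = fun _ => (0 : ℝ) := funext fun y => hperp y
    have hfd : fderiv ℝ (fun y : E3 => ⟪y, ω y⟫) z h = 0 := by
      rw [hzero]
      simp
    have hid : DifferentiableAt ℝ (fun y : E3 => y) z := differentiableAt_fun_id
    rw [fderiv_inner_apply ℝ hid (hd z), fderiv_fun_id, ContinuousLinearMap.id_apply] at hfd
    rw [hA]
    linarith
  -- (3) the trace of `A` vanishes
  have h3 : A (EuclideanSpace.single 0 1) 0 + A (EuclideanSpace.single 1 1) 1 = 0 := by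
    have ht := hdiv z
    rw [divergence_eq_sum_inner_fderiv (EuclideanSpace.basisFun (Fin 3) ℝ)] at ht
    simp only [Fin.sum_univ_three, EuclideanSpace.basisFun_apply, EuclideanSpace.inner_single_left, map_one,
      one_mul] at ht
    rw [← hA, h2] at ht
    linarith
  -- the two horizontal identities, in coordinates
  have e0 := h1 (EuclideanSpace.single 0 1)
  have e1 := h1 (EuclideanSpace.single 1 1)
  have h20 := h2 (EuclideanSpace.single 0 1)
  have h21 := h2 (EuclideanSpace.single 1 1)
  rw [EuclideanSpace.inner_single_left, map_one, one_mul] at e0 e1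
  simp only [PiLp.inner_apply, RCLike.inner_apply, conj_trivial, Fin.sum_univ_three] at e0 e1
  rw [h20] at e0
  rw [h21] at e1
  have hrg : rotGen z = (-(z 1)) • EuclideanSpace.single (0 : Fin 3) (1 : ℝ) + (z 0) • EuclideanSpace.single (1 : Fin 3) (1 : ℝ) := by
    ext i
    fin_cases i <;> simp [rotGen]
  rw [hrg, map_add, map_smul, map_smul]
  ext i
  fin_cases i
  · simp only [Fin.zero_eta, Fin.isValue, PiLp.add_apply, PiLp.smul_apply, smul_eq_mul, rotGen_apply_zero]
    linear_combination e1 - (z 1) * h3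
  · simp only [Fin.mk_one, Fin.isValue, PiLp.add_apply, PiLp.smul_apply, smul_eq_mul, rotGen_apply_one]
    linear_combination (-1 : ℝ) * e0 + (z 0) * h3
  · simp only [Fin.reduceFinMk, Fin.isValue, PiLp.add_apply, PiLp.smul_apply, smul_eq_mul, rotGen_apply_two, h20, h21]
    ring

/-- **A horizontal, unthreaded, solenoidal `C¹` field on `ℝ³` is axisymmetric about the `x₂`-axis** (the key lemma integrated along the rotation
orbits, `TiltedIsotropy.isAxisymmetric_of_fderiv_rotGen`).  In cylindrical language: `ω ⊥ e_z`, `ω ⊥ y` force `ω = f e_θ`, and `div ω = 0` forces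
`∂_θ f = 0`. [folklore] -/
theorem isAxisymmetric_of_horizontal_unthreaded {ω : E3 → E3} (hd : Differentiable ℝ ω) (hz : ∀ y, ω y 2 = 0)
    (hperp : ∀ y, ⟪y, ω y⟫ = 0) (hdiv : VectorCalculus.IsDivFree ω) : IsAxisymmetric ω :=
  isAxisymmetric_of_fderiv_rotGen hd fun z => fderiv_rotGen_eq_rotGen hd hz hperp hdiv z

/-! ### The coboundary: axisymmetric curl ⇒ axisymmetric field modulo a constant -/

/-- **COBOUNDARY LEMMA.**  If `W : ℝ³ → ℝ³` is `C²`, bounded and divergence free and its curl is axisymmetric, then `W − W(0)` is axisymmetric: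
for every angle `θ`, `R_θ W R_{−θ} − W` is bounded, divergence free and curl free (`curl (R_θ W R_{−θ}) = R_θ (curl W) R_{−θ} = curl W`), hence a
constant (KNSS 2009 Lemma 3.1, `eq_of_curl_eq_zero_of_isDivFree_of_bounded`), which evaluated at the axis point `0` is `R_θ W(0) − W(0)`.
[cite: KochNadirashviliSereginSverak2009, Lemma 3.1 (arXiv:0709.3599 p. 7)] -/
theorem isAxisymmetric_sub_apply_zero {W : E3 → E3} (hW : ContDiff ℝ 2 W) {M : ℝ} (hM : ∀ x, ‖W x‖ ≤ M)
    (hdiv : VectorCalculus.IsDivFree W) (hax : IsAxisymmetric (curl W)) :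
    IsAxisymmetric (fun y => W y - W 0) := by
  intro θ x
  have hWd : Differentiable ℝ W := hW.differentiable (by norm_num)
  set Wθ : E3 → E3 := fun y => rotZ θ (W (rotZ (-θ) y)) with hWθ
  have hWθ' : Wθ = fun y => rotZLIE θ (W ((rotZLIE θ).symm y)) := by
    funext y
    simp [hWθ]
  have hWθ2 : ContDiff ℝ 2 Wθ := by
    rw [hWθ']
    exact (rotZLIE θ).contDiff.comp (hW.comp (rotZLIE θ).symm.contDiff)
  have hWθd : Differentiable ℝ Wθ := hWθ2.differentiable (by norm_num)
  have hdivθ : VectorCalculus.IsDivFree Wθ := by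
    rw [hWθ']
    exact hdiv.conj_linearIsometryEquiv (rotZLIE θ)
  have hcurlθ : ∀ y, curl Wθ y = curl W y := fun y => by
    rw [hWθ, PineauVicol2026.curl_rotZ_conj hWd θ y]
    exact hax.rotZ_apply_rotZ_neg θ y
  -- the difference is bounded, divergence free and curl free, hence constant
  have hD2 : ContDiff ℝ 2 (fun y => Wθ y - W y) := hWθ2.sub hW
  have hDcurl : ∀ y, curl (fun y => Wθ y - W y) y = 0 := fun y => by
    rw [curl_sub (hWθd y) (hWd y), hcurlθ, sub_self]
  have hDdiv : VectorCalculus.IsDivFree (fun y => Wθ y - W y) := hdivθ.sub hWθd hWd hdiv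
  have hDbd : ∀ y, ‖Wθ y - W y‖ ≤ M + M := fun y => by
    refine (norm_sub_le _ _).trans (add_le_add ?_ (hM y))
    rw [hWθ]
    simp only [norm_rotZ]
    exact hM _
  have hconst := eq_of_curl_eq_zero_of_isDivFree_of_bounded hD2 hDcurl hDdiv hDbd (rotZ θ x) 0
  -- unfold the constant at `0` and at `R_θ x`
  have hback : rotZ (-θ) (rotZ θ x) = x := by rw [← rotZ_add, neg_add_cancel, rotZ_zero]
  have hzero : rotZ (-θ) (0 : E3) = 0 := by
    rw [← rotZL_apply, map_zero]
  simp only [hWθ, hback, hzero] at hconst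
  -- hconst : rotZ θ (W x) - W (rotZ θ x) = rotZ θ (W 0) - W 0
  have hlin : rotZ θ (W x - W 0) = rotZ θ (W x) - rotZ θ (W 0) := by
    rw [← rotZL_apply, ← rotZL_apply, ← rotZL_apply, map_sub]
  rw [hlin]
  calc W (rotZ θ x) - W 0
      = rotZ θ (W x) - (rotZ θ (W x) - W (rotZ θ x)) - W 0 := by abel
    _ = rotZ θ (W x) - (rotZ θ (W 0) - W 0) - W 0 := by rw [hconst]
    _ = rotZ θ (W x) - rotZ θ (W 0) := by abel

/-- **Kinematic conclusion in the straightened frame.**  A `C²`, bounded, divergence-free field `W` on `ℝ³` whose curl is horizontal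
(`(curl W)₂ ≡ 0`) and unthreaded about the origin (`⟪y, curl W (y)⟫ ≡ 0`) is, after subtracting `W(0)`, axisymmetric WITHOUT swirl about the
`x₂`-axis (`div curl = 0` from `divergence_curl_eq_zero_holds`; axisymmetry by the key lemma and the coboundary lemma; no swirl by
`hasNoSwirl_of_isAxisymmetric_of_curl_two_eq_zero`). [folklore] -/
theorem axisymmetricNoSwirl_sub_apply_zero {W : E3 → E3} (hW : ContDiff ℝ 2 W) {M : ℝ} (hM : ∀ x, ‖W x‖ ≤ M)
    (hdiv : VectorCalculus.IsDivFree W) (hz : ∀ y, curl W y 2 = 0) (hperp : ∀ y, ⟪y, curl W y⟫ = 0) :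
    IsAxisymmetric (fun y => W y - W 0) ∧ HasNoSwirl (fun y => W y - W 0) := by
  have hWd : Differentiable ℝ W := hW.differentiable (by norm_num)
  have hω1 : ContDiff ℝ 1 (curl W) := contDiff_curl (n := 1) (by simpa [one_add_one_eq_two] using hW)
  have hωd : Differentiable ℝ (curl W) := hω1.differentiable one_ne_zero
  have hωdiv : VectorCalculus.IsDivFree (curl W) := fun y => divergence_curl_eq_zero_holds W hW y
  have hax : IsAxisymmetric (curl W) := isAxisymmetric_of_horizontal_unthreaded hωd hz hperp hωdiv
  have hV : IsAxisymmetric (fun y => W y - W 0) := isAxisymmetric_sub_apply_zero hW hM hdiv hax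
  refine ⟨hV, hasNoSwirl_of_isAxisymmetric_of_curl_two_eq_zero (hWd.sub_const (W 0)) hV fun y => ?_⟩
  have hc : curl (fun y => W y - W 0) y = curl W y := by
    rw [curl_eq_curlCLM, curl_eq_curlCLM, fderiv_sub_const]
  rw [hc]
  exact hz y

/-! ### The frame change -/

/-- The curl of `conjAxis R p u = R ∘ u ∘ (R⁻¹ · + p)` against a direction `e'` vanishes iff the curl of `u` at the pre-image point is orthogonal to
`R⁻¹ e'` (pseudovector law `inner_curl_conj_linearIsometryEquiv_eq_zero_iff` + translation). [folklore] -/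
theorem inner_curl_conjAxis_eq_zero_iff (R : E3 ≃ₗᵢ[ℝ] E3) (p : E3) (u : E3 → E3) (y e' : E3) :
    ⟪curl (conjAxis R p u) y, e'⟫ = 0 ↔ ⟪curl u (R.symm y + p), R.symm e'⟫ = 0 := by
  have h2 : curl (fun z => u (z + p)) (R.symm y) = curl u (R.symm y + p) := by
    rw [curl_eq_curlCLM, curl_eq_curlCLM, fderiv_comp_add_right]
  have key := inner_curl_conj_linearIsometryEquiv_eq_zero_iff R (fun z => u (z + p)) y e'
  rw [h2] at key
  exact key

/-- **One slice, any frame straightening `e`**: a `C²`, bounded, divergence-free field `u` on `ℝ³` whose curl is orthogonal to `x − x₀` and to a fixed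
`e ≠ 0` is — after subtracting `u x₀` — axisymmetric without swirl about the axis through `x₀` straightened by the reflection `R` exchanging
`e/‖e‖` and `e_z` (`Submodule.reflection_sub`). [folklore] -/
theorem exists_isAxisymmetricNoSwirlAbout_sub {u : E3 → E3} (hu : ContDiff ℝ 2 u) {M : ℝ} (hM : ∀ x, ‖u x‖ ≤ M)
    (hdiv : VectorCalculus.IsDivFree u) {x₀ e : E3} (he : e ≠ 0)
    (hperp : ∀ x, ⟪x - x₀, curl u x⟫ = 0) (hzon : ∀ x, ⟪e, curl u x⟫ = 0) :
    ∃ R : E3 ≃ₗᵢ[ℝ] E3, IsAxisymmetricNoSwirlAbout R x₀ (fun y => u y - u x₀) := by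
  -- the frame: a linear isometry with `R⁻¹ e_z = e/‖e‖`
  set ez : E3 := EuclideanSpace.single (2 : Fin 3) (1 : ℝ) with hez
  set u₁ : E3 := ‖e‖⁻¹ • e with hu₁
  have hne : ‖e‖ ≠ 0 := norm_ne_zero_iff.2 he
  have hn1 : ‖u₁‖ = ‖ez‖ := by
    have h1 : ‖u₁‖ = 1 := by
      rw [hu₁, norm_smul, norm_inv, norm_norm, inv_mul_cancel₀ hne]
    have h2 : ‖ez‖ = 1 := by
      rw [hez]
      simp
    rw [h1, h2]
  set R : E3 ≃ₗᵢ[ℝ] E3 := (ℝ ∙ (u₁ - ez))ᗮ.reflection with hR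
  have hRu : R u₁ = ez := Submodule.reflection_sub hn1
  have hRs : R.symm ez = u₁ := by
    rw [← hRu]
    exact R.symm_apply_apply u₁
  refine ⟨R, ?_⟩
  -- the conjugated field
  set W : E3 → E3 := conjAxis R x₀ u with hW
  have hkey : conjAxis R x₀ (fun y => u y - u x₀) = fun y => W y - W 0 := by
    funext y
    simp [hW, conjAxis, map_sub]
  have hW2 : ContDiff ℝ 2 W :=
    R.contDiff.comp (hu.comp ((R.symm.contDiff).add contDiff_const))
  have hWM : ∀ y, ‖W y‖ ≤ M := fun y => by
    rw [hW, conjAxis_apply, LinearIsometryEquiv.norm_map]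
    exact hM _
  have hWdiv : VectorCalculus.IsDivFree W := (hdiv.comp_add_right x₀).conj_linearIsometryEquiv R
  have hWz : ∀ y, curl W y 2 = 0 := fun y => by
    have h : ⟪curl W y, ez⟫ = 0 := by
      rw [hW, inner_curl_conjAxis_eq_zero_iff, hRs, hu₁, real_inner_smul_right, real_inner_comm, hzon, mul_zero]
    simpa [hez, EuclideanSpace.inner_single_right] using h
  have hWperp : ∀ y, ⟪y, curl W y⟫ = 0 := fun y => by
    rw [real_inner_comm, hW, inner_curl_conjAxis_eq_zero_iff]
    have h := hperp (R.symm y + x₀)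
    rwa [add_sub_cancel_right, real_inner_comm] at h
  show IsAxisymmetric (conjAxis R x₀ fun y => u y - u x₀) ∧ HasNoSwirl (conjAxis R x₀ fun y => u y - u x₀)
  rw [hkey]
  exact axisymmetricNoSwirl_sub_apply_zero hW2 hWM hWdiv hWz hWperp

/-! ### Z-1a -/

/-- **Z-1a `ZonalKinematic` (cell-flux Z skeleton v1.1; the Theorems-side twin `CellFlux.ZonalKinematic`, body VERBATIM).**  At every `t < 0` an
unthreaded (`ω = ∇T × (x − x₀)`), zonal (`ω(t) ⊥ e(t) ≠ 0`) slice of a bounded ancient mild solution smooth on the slab is, minus the constant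
`v t x₀`, EXACTLY axisymmetric without swirl about the axis `x₀ + ℝ e(t)` in a straightening frame: the slice is smooth, bounded and (weakly ⇒
classically) divergence free, `ω ⊥ x − x₀` because a cross product is orthogonal to its factors, and `exists_isAxisymmetricNoSwirlAbout_sub` applies.
[folklore] -/
theorem zonalKinematic : ZonalKinematic := by
  intro v x₀ T hB hmeas hsmooth hlink hzon t ht
  obtain ⟨e, he, hze⟩ := hzon t ht
  have hsm : IsSmoothSpaceTimeOn (Iio 0) v := hsmooth
  have hvt : ContDiff ℝ (⊤ : ℕ∞) (v t) := hsm.contDiff_slice ht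
  have hv2 : ContDiff ℝ 2 (v t) := hvt.of_le (by norm_cast)
  have hv1 : ContDiff ℝ 1 (v t) := hvt.of_le (by norm_cast)
  have hdiv : VectorCalculus.IsDivFree (v t) := (hB.isAncientMildSolution.1 t ht).isDivFree_of_contDiff hv1
  obtain ⟨M, hM⟩ := hB.isBoundedOn
  have hperp : ∀ x, ⟪x - x₀, curl (v t) x⟫ = 0 := fun x => by
    rw [hlink t ht x, real_inner_comm]
    exact inner_cross_self_right _ _
  obtain ⟨R, hR⟩ := exists_isAxisymmetricNoSwirlAbout_sub hv2 (fun x => hM t ht x) hdiv he hperp (hze)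
  exact ⟨R, v t x₀, hR⟩

end Summit.NavierStokesRegularity.NavierStokesRegularity.Theorems.PoloidalLiouville.CellFlux

end
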